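import Summits.QuantumFields.YangMills.Theses.UniversalDetector
import Summits.QuantumFields.YangMills.Theorems.FixedTorusFirstTorusHankelCeiling
import Summits.QuantumFields.YangMills.Theorems.FixedTorusFirstTorusHankelLongitudinal
import Summits.QuantumFields.YangMills.Theorems.FixedTorusFirstAssembly
import Summits.QuantumFields.YangMills.Theorems.UniversalDetectorDetectorExists
import Summits.QuantumFields.YangMills.Theorems.UniversalDetectorBlindRigidity
import Summits.QuantumFields.YangMills.Theorems.FixedTorusFirstCompactDetectorTransfer
import Summits.QuantumFields.YangMills.Theorems.UniversalDetectorBlindSeqExtraction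
import HarnessLib

/-!
# Crux `BalabanLadder.NT` (stmt-QuantumFields-19353) — LINE «engine tori» (ym-idea-8 g11-2), birth skeleton

Filed on route `route-QuantumFields-FixedTorusFirst` (rev 1, commit ca4f807b34ad).  Rev 5 of this workfile decides `NT`
from SIX named obligations, THREE still stubs = the route's three open CRUXES (`stub_blindSeqExtraction` := the landed
`Cruxes.UniversalDetectorBlindExtraction.blindSeqExtraction`, ✓p707587 ★ spine g26; `stub_blindDetectorRigidity` := the landed
`Cruxes.BlindDetectorRigidity.blindDetectorRigidity`, ✓p705845 w4; `stub_compactDetectorTransfer` := the landed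
`fixedTorusFirst_compactDetectorTransfer`, ✓p707314 this pen): the deciding ∃-crux `SomeTorusEdgeBit` (stmt-QuantumFields-24174: a unit `a → 0`, a TORUS-SELECTION
FUNCTION `Lsel` with `a·Lsel → ∞`, the one-annulus diagonal axis ceiling EDGE_T on the engine torus and the bit
NONCONTACT_Ω,T along limits over engine tori), the residual crux `SkewOnSomeTorus` (stmt-QuantumFields-24178, clause (ii)),
the route's infrared crux `FiniteSizeInsensitivity` (stmt-QuantumFields-27355, unchanged), and THREE obligations that
compose — kernel-checked, `someTorusDetector_of` below — to the XL support `SomeTorusDetector` (stmt-QuantumFields-24177):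
`BlindSeqExtraction` and `BlindDetectorRigidity` (VERBATIM the Props of LINE g11-1, `Cruxes/NT/Lines/blind_detector.lean`,
being proved by ★ym-spine-19353-p1 resp. ym-line-sfw-p2-w4) and the torus-specific `CompactDetectorTransfer` (M/L: the
universal Gaussian detector is not compactly supported; on the engine tori the plane ceilings at time separation `≥ 2ta`
make `Q2(θ·, ·)` L¹×L¹-continuous, so a compactly supported truncation costs `ε`).  The two reflection-positivity supports
of the line are ALREADY PROVED and cited by name: `fixedTorusFirst_torusHankelCeiling` (24175, p704149) and
`fixedTorusFirst_torusHankelLongitudinal` (24176, p704218), as is the route's `Assembly` (`Theorems.fixedTorusFirst_assembly`).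
`NT_of` is the route's `closes` (rev 1) with those proofs and `someTorusDetector_of` plugged in — no sorry outside the three remaining
`stub_*` = {24174 engine bit, 24178 residual, 27355 IR crux}; item 24177 `SomeTorusDetector` is thereby PROVED (Theorems-side:
`someTorusDetector_of_blindSeqExtraction` ✓p707923 applied to the extraction, file `Theorems/FixedTorusFirstSomeTorusDetector.lean`).

Also proved here (no sorry): `someTorusEdgeBit_of_schemeEdgeBit` — the engine-tori crux 24174 is IMPLIED by the
volume-uniform crux `UniversalDetector.SchemeEdgeBit` (24146) of LINE g11-1 (choose `Lsel β := ⌈(|β|+1)/a β⌉₊`), i.e. this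
line asks strictly less of the UV engine on the ultraviolet side; kept in this workfile (not in `Theorems/`) so that no
item is closed by an implication between open cruxes.

LEVER (lens «dual»): the volume quantifier of `NT` is dual to a choice function — by diagonalisation a fixed-physical-torus
UV engine with Λ-independent constants is the same as bounds on ONE torus `Lsel β` per coupling with `a β·Lsel β → ∞`; the
blind detector's extraction is sequential, so it runs along `(β_k, Lsel β_k)`.  No summit, rung or crux is proved by this
file; NOT registered with `skeleton check` (the fleet's v4T registry on 19353 stays the record).
-/

set_option autoImplicit false

noncomputable section

open MeasureTheory Filter Topology
open Literature.MathematicalPhysics.QuantumFieldTheory Literature.MathematicalPhysics.QuantumLattice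
  Literature.Probability.LatticeModels
open Summit.QuantumFields.YangMills.Cruxes.OSLegsFromFemtoAndGap.DlrCollarTransfer

namespace Summit.QuantumFields.YangMills.Cruxes.NT.EngineTori

open Summit.QuantumFields.YangMills.Theses.FixedTorusFirst
open Summit.QuantumFields.YangMills.Cruxes.FixedTorusFirstEngineTori
  (fixedTorusFirst_torusHankelCeiling fixedTorusFirst_torusHankelLongitudinal)

/-- A torus-selection function along which the physical size diverges: `a β · ⌈(|β| + 1)/a β⌉₊ ≥ |β| + 1`. -/
theorem tendsto_mul_ceil_sel (a : ℝ → ℝ) (ha : ∀ β, 0 < a β) :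
    Tendsto (fun β : ℝ => a β * ((⌈(|β| + 1) / a β⌉₊ : ℕ) : ℝ)) atTop atTop := by
  refine Filter.tendsto_atTop_mono (fun β => ?_)
    (Filter.tendsto_atTop_add_const_right atTop (1 : ℝ) tendsto_abs_atTop_atTop)
  have haβ := ha β
  have hc : (|β| + 1) / a β ≤ ((⌈(|β| + 1) / a β⌉₊ : ℕ) : ℝ) := Nat.le_ceil _
  calc |β| + 1 = a β * ((|β| + 1) / a β) := by field_simp
    _ ≤ a β * ((⌈(|β| + 1) / a β⌉₊ : ℕ) : ℝ) := mul_le_mul_of_nonneg_left hc haβ.le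

/-- `SchemeEdgeBit ⟹ SomeTorusEdgeBit`: the engine-tori crux of route `FixedTorusFirst` (stmt-QuantumFields-24174)
follows from the volume-uniform crux of route `UniversalDetector` (stmt-QuantumFields-24146). -/
theorem someTorusEdgeBit_of_schemeEdgeBit
    (h : Summit.QuantumFields.YangMills.Theses.UniversalDetector.SchemeEdgeBit) :
    Summit.QuantumFields.YangMills.Theses.FixedTorusFirst.SomeTorusEdgeBit := by
  intro G _ _ _ _ hG
  letI : MeasurableSpace G := borel G
  haveI : BorelSpace G := ⟨rfl⟩
  obtain ⟨r, a, ha, hlim, hE, hN⟩ := h G hG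
  have hgrow := tendsto_mul_ceil_sel a ha
  refine ⟨r, a, fun β => ⌈(|β| + 1) / a β⌉₊, ha, hlim, hgrow, ?_, ?_⟩
  · -- EDGE_T from the volume-uniform EDGE, on the engine torus once `Λ₅ ≤ a β · Lsel β`
    obtain ⟨η₀, hη₀, hE⟩ := hE
    refine ⟨η₀, hη₀, fun η hη hηle => ?_⟩
    obtain ⟨C, β₅, Λ₅, hC⟩ := hE η hη hηle
    obtain ⟨βg, hβg⟩ := Filter.eventually_atTop.1 (hgrow.eventually_ge_atTop Λ₅)
    refine ⟨C, max β₅ βg, fun β hβ q hq k m h1 h2 => ?_⟩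
    exact hC β (le_trans (le_max_left _ _) hβ) _ (hβg β (le_trans (le_max_right _ _) hβ)) q hq k m h1 h2
  · -- NONCONTACT_Ω,T: engine tori form an admissible sequence of NONCONTACT_Ω
    intro βs K hβs hconv
    exact hN βs (fun k => ⌈(|βs k| + 1) / a (βs k)⌉₊) K hβs (hgrow.comp hβs) hconv


/-! ## Registered-shape stubs (the four open items of the line, BY NAME) and the composition -/

/-! ### The torus-family detector run (item 24177 `SomeTorusDetector`, XL) cut into three named obligations

The two analysis stubs are the SAME Props as LINE g11-1's (`Cruxes/NT/Lines/blind_detector.lean`, namespace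
`…Cruxes.NT.BlindDetector`) — copied VERBATIM (identical terms, so one proof serves both by `Iff.rfl`); they are being
proved by ★ym-spine-19353-p1 (extraction) and ym-line-sfw-p2-w4 (rigidity).  The third, `CompactDetectorTransfer`, is the
only torus-specific piece (M/L): from the plane ceilings `BDD6_T` at time separation `≥ 2·ta`, `|Q2(θf, g)| ≲ C(2ta)·‖f‖₁‖g‖₁`
uniformly on the engine tori (bilinearity of `Q2`, `dens = Σ plane`, torus translation invariance, Schwartz Riemann sums),
so the universal Gaussian detector `v₀` (NOT compactly supported) is replaced by a compactly supported truncation at an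
`ε`-cost in `Q2(θv, v)` — which is what clause (i) of `SomeTorusFloors` (with `HasCompactSupport v`) needs. -/

/-- STUB X (analysis, XL) — VERBATIM copy of `Cruxes.NT.BlindDetector.BlindSeqExtraction` (LINE g11-1, stub 1 of item
24148): blind sequential limit extraction on `Ω = {all zᵢ ≠ 0}` along ANY sequence of schemes `(βs, Ls)` with
`a·Ls → ∞` carrying the plane ceilings eventually. -/
def BlindSeqExtraction : Prop :=
  open MeasureTheory Literature.MathematicalPhysics.QuantumFieldTheory Literature.MathematicalPhysics.QuantumLattice Literature.Probability.LatticeModels Summit.QuantumFields.YangMills.Cruxes.OSLegsFromFemtoAndGap.DlrCollarTransfer in ∀ (G : Type) [Group G] [TopologicalSpace G] [IsTopologicalGroup G] [CompactSpace G], IsCompactSimpleLieGroup G → letI : MeasurableSpace G := borel G; haveI : BorelSpace G := ⟨rfl⟩; ∀ (r : LatticeRep G) (a : ℝ → ℝ), (∀ β, 0 < a β) → Filter.Tendsto a Filter.atTop (nhds 0) → let ker : ℝ → ℕ → (Fin 4 → ℤ) → ℝ := (fun (β : ℝ) (L : ℕ) (z : Fin 4 → ℤ) => (a β)⁻¹ ^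 8 * (torusE G r β L (fun U => dens G r 0 U * dens G r z U) - torusE G r β L (dens G r 0) * torusE G r β L (dens G r z))); let ker6 : ℝ → ℕ → Fin 4 × Fin 4 → Fin 4 × Fin 4 → (Fin 4 → ℤ) → ℝ := (fun (β : ℝ) (L : ℕ) (p q : Fin 4 × Fin 4) (z : Fin 4 → ℤ) => (a β)⁻¹ ^ 8 * (torusE G r β L (fun U => plane G r p 0 U * plane G r q z U) - torusE G r β L (plane G r p 0) * torusE G r β L (plane G r q z))); ∀ (βs : ℕ → ℝ) (Ls : ℕ → ℕ), Filter.Tendsto βs Filter.atTop Filter.atTop → Filter.Tendsto (fun k => a (βs k) * Ls k) Filter.atTop Filter.atTop → (∀ p q : Fin 4 × Fin 4, p.1 < p.2 → q.1 < q.2 → ∀ η : ℝ, 0 < η → ∃ C : ℝ, ∃ k₀ : ℕ, ∀ m : ℕ, k₀ ≤ m → ∀ z ∈ box 4 (Ls m), η ≤ ‖a (βs m) • siteToE z‖ → |ker6 (βs m) (Ls m) p q z| ≤ C) → (∀ p q : Fin 4 × Fin 4, p.1 < p.2 → q.1 < q.2 → ∀ η : ℝ, 0 < η → ∀ τ : ℝ,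 0 < τ → ∃ Λ : ℝ, ∃ k₀ : ℕ, ∀ m : ℕ, k₀ ≤ m → ∀ (k : Fin 4) (z : Fin 4 → ℤ) (n : ℕ), (∀ j : ℕ, j ≤ n → z + Pi.single k (j : ℤ) ∈ box 4 (Ls m) ∧ η ≤ ‖a (βs m) • siteToE (z + Pi.single k (j : ℤ))‖ ∧ τ ≤ |a (βs m) * (z k + j)|) → |ker6 (βs m) (Ls m) p q z - ker6 (βs m) (Ls m) p q (z + Pi.single k (n : ℤ))| ≤ Λ * (a (βs m) * n)) → ∃ (φ : ℕ → ℕ) (K : EuclideanSpace ℝ (Fin 4) → ℝ), StrictMono φ ∧ (∀ η ε : ℝ, 0 < η → 0 < ε → ∃ k₀ : ℕ, ∀ k : ℕ, k₀ ≤ k → ∀ z ∈ box 4 (Ls (φ k)), (∀ i : Fin 4, η ≤ |a (βs (φ k)) * (z i : ℝ)|) → ‖a (βs (φ k)) • siteToE z‖ ≤ η⁻¹ → |ker (βs (φ k)) (Ls (φ k)) z - K (a (βs (φ k)) • siteToE z)| ≤ ε) ∧ Measurable K ∧ ContinuousOn K {z | ∀ i : Fin 4, z i ≠ 0} ∧ (∀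 η : ℝ, 0 < η → ∃ C : ℝ, ∀ z : EuclideanSpace ℝ (Fin 4), η ≤ ‖z‖ → |K z| ≤ C) ∧ (∀ z : EuclideanSpace ℝ (Fin 4), K (-z) = K z) ∧ (∀ z : EuclideanSpace ℝ (Fin 4), K (timeReflection 4 z) = K z) ∧ (∀ (w : SchwartzMap (EuclideanSpace ℝ (Fin 4)) ℝ) (t₀ T : ℝ), 0 < t₀ → tsupport (w : EuclideanSpace ℝ (Fin 4) → ℝ) ⊆ {y | t₀ ≤ y 0 ∧ y 0 ≤ T} → 0 ≤ ∫ x, ∫ y, (thetaTest 4 w) x * w y * K (y - x)) ∧ (∀ (w₁ w₂ : SchwartzMap (EuclideanSpace ℝ (Fin 4)) ℝ) (t₀ T : ℝ), 0 < t₀ → tsupport (w₁ : EuclideanSpace ℝ (Fin 4) → ℝ) ⊆ {y | t₀ ≤ -(y 0) ∧ -(y 0) ≤ T} → tsupport (w₂ : EuclideanSpace ℝ (Fin 4) → ℝ) ⊆ {y | t₀ ≤ y 0 ∧ y 0 ≤ T} → Filter.Tendsto (fun k => Q2 G r (βs (φ k)) (Ls (φ k)) (a (βs (φ k))) w₁ w₂)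 Filter.atTop (nhds (∫ x, ∫ y, w₁ x * w₂ y * K (y - x))))

/-- STUB R (analysis, L) — VERBATIM copy of `Cruxes.NT.BlindDetector.BlindDetectorRigidity` (LINE g11-1, stub 2 of item
24148): a measurable, `Ω`-continuous, even, `ϑ`-invariant, RP kernel bounded off every ball, killed by the universal
Gaussian detector, vanishes on `Ω`. -/
def BlindDetectorRigidity : Prop :=
  open MeasureTheory Literature.MathematicalPhysics.QuantumLattice in ∀ (K : EuclideanSpace ℝ (Fin 4) → ℝ) (h : ℝ → ℝ) (ta tb : ℝ) (v₀ : SchwartzMap (EuclideanSpace ℝ (Fin 4)) ℝ), Measurable K → ContinuousOn K {z | ∀ i : Fin 4, z i ≠ 0} → (∀ η : ℝ, 0 < η → ∃ C : ℝ, ∀ z : EuclideanSpace ℝ (Fin 4), η ≤ ‖z‖ → |K z| ≤ C) → (∀ z : EuclideanSpace ℝ (Fin 4), K (-z) = K z) → (∀ z : EuclideanSpace ℝ (Fin 4), K (timeReflection 4 z) = K z) → (∀ (w : SchwartzMap (EuclideanSpace ℝ (Fin 4)) ℝ) (t₀ T : ℝ), 0 < t₀ → tsupport (w : EuclideanSpace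 ℝ (Fin 4) → ℝ) ⊆ {y | t₀ ≤ y 0 ∧ y 0 ≤ T} → 0 ≤ ∫ x, ∫ y, (thetaTest 4 w) x * w y * K (y - x)) → 0 < ta → Continuous h → (∀ t, 0 ≤ h t) → tsupport h ⊆ Set.Icc ta tb → (∃ t, h t ≠ 0) → (∀ y, v₀ y = h (y 0) * Real.exp (-‖y‖ ^ 2)) → (∫ x, ∫ y, (thetaTest 4 v₀) x * v₀ y * K (y - x)) = 0 → ∀ z : EuclideanSpace ℝ (Fin 4), (∀ i : Fin 4, z i ≠ 0) → K z = 0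

/-- STUB T (torus-specific, M/L) — compact-support transfer of the detector on the engine tori: under the plane
ceilings `BDD6_T`, every Schwartz `v₀` supported in a positive time slab `{ta ≤ y₀ ≤ tb}` has, for each `ε > 0`, a
COMPACTLY SUPPORTED Schwartz `v` in the same slab with `|Q2(θv, v) − Q2(θv₀, v₀)| ≤ ε` on every late engine torus
(`|Q2(θf, g)| ≤ C(2ta)·(a⁴Σ|f|)(a⁴Σ|g|)` at time separation `≥ 2ta` from `BDD6_T` + `dens = Σ_p plane_p` + torus
translation invariance; Schwartz tails have uniformly small Riemann sums). -/
def CompactDetectorTransfer : Prop :=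
  open MeasureTheory Literature.MathematicalPhysics.QuantumFieldTheory Literature.MathematicalPhysics.QuantumLattice Literature.Probability.LatticeModels Summit.QuantumFields.YangMills.Cruxes.OSLegsFromFemtoAndGap.DlrCollarTransfer in ∀ (G : Type) [Group G] [TopologicalSpace G] [IsTopologicalGroup G] [CompactSpace G], IsCompactSimpleLieGroup G → letI : MeasurableSpace G := borel G; haveI : BorelSpace G := ⟨rfl⟩; ∀ (r : LatticeRep G) (a : ℝ → ℝ) (Lsel : ℝ → ℕ), (∀ β, 0 < a β) → Filter.Tendsto a Filter.atTop (nhds 0) → Filter.Tendsto (fun β => a β * (Lsel β : ℝ)) Filter.atTop Filter.atTop → let ker : ℝ → ℕ → (Fin 4 → ℤ) → ℝ := (fun (β : ℝ) (L : ℕ) (z : Fin 4 → ℤ) => (a β)⁻¹ ^ 8 * (torusE G r β L (fun U => dens G r 0 U * dens G r z U) - torusE G r β L (dens G r 0) * torusE G r β L (dens G r z))); let ker6 : ℝ → ℕ → Fin 4 × Fin 4 → Fin 4 × Fin 4 → (Fin 4 → ℤ) → ℝ := (fun (β : ℝ) (L : ℕ) (p q : Fin 4 × Fin 4) (z : Fin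 4 → ℤ) => (a β)⁻¹ ^ 8 * (torusE G r β L (fun U => plane G r p 0 U * plane G r q z U) - torusE G r β L (plane G r p 0) * torusE G r β L (plane G r q z))); (∀ p q : Fin 4 × Fin 4, p.1 < p.2 → q.1 < q.2 → ∀ η : ℝ, 0 < η → ∃ (C β₅ : ℝ), ∀ β : ℝ, β₅ ≤ β → ∀ z ∈ box 4 (Lsel β), η ≤ ‖a β • siteToE z‖ → |ker6 β (Lsel β) p q z| ≤ C) → ∀ (v₀ : SchwartzMap (EuclideanSpace ℝ (Fin 4)) ℝ) (ta tb : ℝ), 0 < ta → tsupport (v₀ : EuclideanSpace ℝ (Fin 4) → ℝ) ⊆ {y | ta ≤ y 0 ∧ y 0 ≤ tb} → tsupport ((thetaTest 4 v₀ : SchwartzMap (EuclideanSpace ℝ (Fin 4)) ℝ) : EuclideanSpace ℝ (Fin 4) → ℝ) ⊆ {y | ta ≤ -(y 0) ∧ -(y 0) ≤ tb} → ∀ ε : ℝ, 0 < ε → ∃ (v : SchwartzMap (EuclideanSpace ℝ (Fin 4)) ℝ) (β₅ : ℝ), HasCompactSupport (v : EuclideanSpace ℝ (Fin 4) → ℝ)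 ∧ tsupport (v : EuclideanSpace ℝ (Fin 4) → ℝ) ⊆ {y | ta ≤ y 0 ∧ y 0 ≤ tb} ∧ ∀ β : ℝ, β₅ ≤ β → |Q2 G r β (Lsel β) (a β) (thetaTest 4 v) v - Q2 G r β (Lsel β) (a β) (thetaTest 4 v₀) v₀| ≤ ε

/-- COMPOSITION (kernel-checked, no sorry): the three obligations imply the support item `SomeTorusDetector`
(stmt-QuantumFields-24177).  Step A — Gaussian floors ALONG THE ENGINE TORI by contradiction: a sequence `βₖ → ∞` with
`Q2_{βₖ, Lsel βₖ}(θv₀, v₀) → 0⁻` feeds the blind extraction (ceilings hold eventually since they hold for all late `β`),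
the limit kernel has `∫∫ θv₀ v₀ K = 0`, rigidity kills it on `Ω`, contradicting the bit `NONCONTACT_{Ω,T}`.  Step B — the
transfer stub trades `v₀` for a compactly supported `v` at cost `ε₀/2`, and `L := Lsel β` witnesses clause (i). -/
theorem someTorusDetector_of (hX : BlindSeqExtraction) (hR : BlindDetectorRigidity) (hT : CompactDetectorTransfer) :
    SomeTorusDetector := by
  intro G _ _ _ _ hG r a Lsel ha hlim hgrow ker ker6 hBdd hLong hN
  letI : MeasurableSpace G := borel G
  haveI : BorelSpace G := ⟨rfl⟩
  obtain ⟨v₀, h, ta, tb, hta, hhc, hh0, hhsupp, hhne, hv₀, hsuppv, hsuppθ⟩ :=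
    Summit.QuantumFields.YangMills.Theorems.universalDetector_detectorExists
  -- Step A: a uniform Gaussian floor along the engine tori
  have hfloor : ∃ ε₀ : ℝ, 0 < ε₀ ∧ ∃ β₆ : ℝ, ∀ β : ℝ, β₆ ≤ β →
      ε₀ ≤ Q2 G r β (Lsel β) (a β) (thetaTest 4 v₀) v₀ := by
    by_contra hcon
    push Not at hcon
    choose βs hβs hQs using fun k : ℕ => hcon (1 / ((k : ℝ) + 1)) (by positivity) k
    have hβs' : Filter.Tendsto βs Filter.atTop Filter.atTop :=
      Filter.tendsto_atTop_mono hβs tendsto_natCast_atTop_atTop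
    have haL' : Filter.Tendsto (fun k => a (βs k) * ((fun k => Lsel (βs k)) k : ℝ)) Filter.atTop Filter.atTop :=
      hgrow.comp hβs'
    have hev : ∀ β₅ : ℝ, ∃ k₀ : ℕ, ∀ m : ℕ, k₀ ≤ m → β₅ ≤ βs m := fun β₅ =>
      Filter.eventually_atTop.1 (hβs'.eventually_ge_atTop β₅)
    have hBdd' : ∀ p q : Fin 4 × Fin 4, p.1 < p.2 → q.1 < q.2 → ∀ η : ℝ, 0 < η → ∃ C : ℝ, ∃ k₀ : ℕ, ∀ m : ℕ, k₀ ≤ m → ∀ z ∈ box 4 ((fun k => Lsel (βs k)) m), η ≤ ‖a (βs m) • siteToE z‖ → |ker6 (βs m) ((fun k => Lsel (βs k)) m) p q z| ≤ C := by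
      intro p q hp hq η hη
      obtain ⟨C, β₅, hC⟩ := hBdd p q hp hq η hη
      obtain ⟨k₀, hk₀⟩ := hev β₅
      exact ⟨C, k₀, fun m hm z hz hηz => hC (βs m) (hk₀ m hm) z hz hηz⟩
    have hLong' : ∀ p q : Fin 4 × Fin 4, p.1 < p.2 → q.1 < q.2 → ∀ η : ℝ, 0 < η → ∀ τ : ℝ, 0 < τ → ∃ Λ : ℝ, ∃ k₀ : ℕ, ∀ m : ℕ, k₀ ≤ m → ∀ (k : Fin 4) (z : Fin 4 → ℤ) (n : ℕ), (∀ j : ℕ, j ≤ n → z + Pi.single k (j : ℤ) ∈ box 4 ((fun k => Lsel (βs k)) m) ∧ η ≤ ‖a (βs m) • siteToE (z + Pi.single k (j : ℤ))‖ ∧ τ ≤ |a (βs m) * (z k + j)|) → |ker6 (βs m) ((fun k => Lsel (βs k)) m) p q z - ker6 (βs m) ((fun k => Lsel (βs k)) m) p q (z + Pi.single k (n : ℤ))| ≤ Λ * (a (βs m) * n) := by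
      intro p q hp hq η hη τ hτ
      obtain ⟨Λ, β₅, hΛ⟩ := hLong p q hp hq η hη τ hτ
      obtain ⟨k₀, hk₀⟩ := hev β₅
      exact ⟨Λ, k₀, fun m hm k z n hzn => hΛ (βs m) (hk₀ m hm) k z n hzn⟩
    obtain ⟨φ, K, hφ, hconv, hKm, hKc, hKb, hKe, hKθ, hRP, hQ2lim⟩ :=
      hX G hG r a ha hlim βs (fun k => Lsel (βs k)) hβs' haL' hBdd' hLong'
    have hlimQ := hQ2lim _ v₀ ta tb hta hsuppθ hsuppv
    have hg0 : Filter.Tendsto (fun k => 1 / ((φ k : ℝ) + 1)) Filter.atTop (nhds 0) :=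
      tendsto_one_div_add_atTop_nhds_zero_nat.comp hφ.tendsto_atTop
    have hIle := le_of_tendsto_of_tendsto hlimQ hg0 (Filter.Eventually.of_forall fun k => (hQs (φ k)).le)
    have hI0 := le_antisymm hIle (hRP v₀ ta tb hta hsuppv)
    have hK0 : ∀ z : EuclideanSpace ℝ (Fin 4), (∀ i : Fin 4, z i ≠ 0) → K z = 0 :=
      hR K h ta tb v₀ hKm hKc hKb hKe hKθ hRP hta hhc hh0 hhsupp hhne hv₀ hI0
    obtain ⟨z, hz, hKz⟩ := hN (fun k => βs (φ k)) K (hβs'.comp hφ.tendsto_atTop) hconv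
    exact hKz (hK0 z hz)
  -- Step B: compact-support transfer and the witness `L := Lsel β`
  obtain ⟨ε₀, hε₀, β₆, hfl⟩ := hfloor
  obtain ⟨v, β₇, hvc, hvsupp, hvQ⟩ :=
    hT G hG r a Lsel ha hlim hgrow hBdd v₀ ta tb hta hsuppv hsuppθ (ε₀ / 2) (by positivity)
  refine ⟨v, ε₀ / 2, 0, fun y hy => lt_of_lt_of_le hta (hvsupp hy).1, hvc, by positivity, fun Λ _ => ?_⟩
  obtain ⟨βg, hβg⟩ := Filter.eventually_atTop.1 (hgrow.eventually_ge_atTop Λ)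
  refine ⟨max (max β₆ β₇) βg, fun β hβ => ⟨Lsel β, hβg β (le_of_max_le_right hβ), ?_⟩⟩
  have h1 := hfl β (le_trans (le_max_left _ _) (le_of_max_le_left hβ))
  have h2 := hvQ β (le_trans (le_max_right _ _) (le_of_max_le_left hβ))
  have h3 := (abs_le.1 h2).1
  linarith

/-! ### Stubs and the composition to `NT` -/

/-- STUB (deciding crux, stmt-QuantumFields-24174): the engine-tori bit package (or enter from 24146 via
`someTorusEdgeBit_of_schemeEdgeBit`). -/
theorem stub_someTorusEdgeBit : SomeTorusEdgeBit := by
  sorry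

/-- STUB (residual crux, stmt-QuantumFields-24178): clause (ii) along the engine tori. -/
theorem stub_skewOnSomeTorus : SkewOnSomeTorus := by
  sorry

/-- STUB (crux, stmt-QuantumFields-27355, pre-existing on the route): finite-size insensitivity. -/
theorem stub_finiteSizeInsensitivity : FiniteSizeInsensitivity := by
  sorry

/-- NO LONGER A STUB (rev 4): the blind sequential extraction was PROVED by ★ ym-spine-19353-p1 g26 — ✓p707587
`Theorems/UniversalDetectorBlindSeqExtraction.lean`, decl `Cruxes.UniversalDetectorBlindExtraction.blindSeqExtraction` (verbatim text; six landed
helpers: mesh Arzelà–Ascoli with a gauge, orthant modulus, lattice extraction on orthant annuli, hyperplane cutoffs, blind Q2 template, lattice kernels). -/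
theorem stub_blindSeqExtraction : BlindSeqExtraction :=
  Summit.QuantumFields.YangMills.Cruxes.UniversalDetectorBlindExtraction.blindSeqExtraction

/-- NO LONGER A STUB (rev 3): STUB R was PROVED by ym-line-sfw-p2-w4 g22 — ✓p705845 `Theorems/UniversalDetectorBlindRigidity.lean`
(commit 1f1d45cdc986), decl `Summit.QuantumFields.YangMills.Cruxes.BlindDetectorRigidity.blindDetectorRigidity` (verbatim text). -/
theorem stub_blindDetectorRigidity : BlindDetectorRigidity :=
  Summit.QuantumFields.YangMills.Cruxes.BlindDetectorRigidity.blindDetectorRigidity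

/-- NO LONGER A STUB (rev 4): STUB T was PROVED by this pen — ✓p707314 `Theorems/FixedTorusFirstCompactDetectorTransfer.lean`,
decl `Cruxes.FixedTorusFirstEngineTori.fixedTorusFirst_compactDetectorTransfer` (verbatim text; `v := χ_R·v₀`, plane ceilings at
`2ta`, Schwartz Riemann bounds). -/
theorem stub_compactDetectorTransfer : CompactDetectorTransfer :=
  Summit.QuantumFields.YangMills.Cruxes.FixedTorusFirstEngineTori.fixedTorusFirst_compactDetectorTransfer

/-- COMPOSITION (kernel-checked, no sorry): the stubs decide the crux `BalabanLadder.NT` BY NAME, through the route's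
`closes` (rev 1) with the proved supports `fixedTorusFirst_torusHankelCeiling` (p704149), `fixedTorusFirst_torusHankelLongitudinal`
(p704218), the proved `Assembly` and `someTorusDetector_of` plugged in. -/
theorem NT_of : SomeTorusEdgeBit → SkewOnSomeTorus → FiniteSizeInsensitivity → BlindSeqExtraction →
    BlindDetectorRigidity → CompactDetectorTransfer → Summit.QuantumFields.YangMills.Theses.BalabanLadder.NT :=
  fun hB hS h2 hX hR hT => Summit.QuantumFields.YangMills.Theses.FixedTorusFirst.closes hB
    fixedTorusFirst_torusHankelCeiling fixedTorusFirst_torusHankelLongitudinal (someTorusDetector_of hX hR hT) hS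
    Summit.QuantumFields.YangMills.Theorems.fixedTorusFirst_assembly h2

/-- The same composition entered from LINE g11-1's volume-uniform crux `UniversalDetector.SchemeEdgeBit` (24146). -/
theorem NT_of_schemeEdgeBit : Summit.QuantumFields.YangMills.Theses.UniversalDetector.SchemeEdgeBit →
    SkewOnSomeTorus → FiniteSizeInsensitivity → BlindSeqExtraction → BlindDetectorRigidity → CompactDetectorTransfer →
    Summit.QuantumFields.YangMills.Theses.BalabanLadder.NT :=
  fun hE hS h2 hX hR hT => NT_of (someTorusEdgeBit_of_schemeEdgeBit hE) hS h2 hX hR hT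

/-- `NT` from the stubs (sorries live only inside the six `stub_*`). -/
theorem NT_of_stubs : Summit.QuantumFields.YangMills.Theses.BalabanLadder.NT :=
  NT_of stub_someTorusEdgeBit stub_skewOnSomeTorus stub_finiteSizeInsensitivity stub_blindSeqExtraction
    stub_blindDetectorRigidity stub_compactDetectorTransfer

end Summit.QuantumFields.YangMills.Cruxes.NT.EngineTori

end
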